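import Summits.QuantumFields.YangMills.Theorems.FlatTubeReductionDecimationMergeStep
import Summits.QuantumFields.YangMills.Theorems.FlatTubeReductionDecimationSelection
import HarnessLib

/-!
# Route `FlatTubeReduction`, crux `PinnedUnitStepEx` (stmt-QuantumFields-27561), stub `stub_smearVarPosGS1` — E2d-1: terms of trivial decoders

Seat ym-line-fcl-p3 g9 (2026-08-28).  Blueprint v2 §E2 (b)–(c) assembled into reusable identities for the readings
`W_{m̄,v}(U)(x,i) = thin L' (τ_v U)(x − m̄, i)`:
* `esPart_shiftLinks_reading` — for a translation-invariant `g`, the term of a decoder whose link set is a translate, `g^{=R₁ − m̄}(thin(τ_v U))`, is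
  `g^{=R₁}(W_{m̄,v} U)` (`esPart_image_shift`);
* `esPart_reading_steps` — `n` merge steps in direction `j` through transverse-free slices: `g^{=R}(W_{m̄+n e_j, v−n e_j} U) = g^{=R}(W_{m̄,v} U)`
  (`esPart_reading_step` iterated);
* `esPart_reading_polyakov` — in a direction in which `R` is translation invariant and every slice is transverse-free (Polyakov lines), the reading
  may be rotated freely: `g^{=R}(W_{m̄, v−n e_j} U) = g^{=R}(W_{m̄,v} U)`.
R2b1 RECORD rung; no summit/crux/stub here.
-/

set_option autoImplicit false

noncomputable section

namespace Summit.QuantumFields.YangMills.Theorems.FlatTubeReduction.Decimation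

open MeasureTheory Finset Function
open Literature.MathematicalPhysics.QuantumFieldTheory (Site Edge GaugeConfig gaugeTransform haarProbability)
open Literature.MathematicalPhysics.QuantumFieldTheory.TorusTranslation
open Summit.QuantumFields.YangMills.Theorems.FemtoCutoffLadder.Thinning
open Literature.Probability.Independence.Hoeffding

variable {G : Type*} [Group G] [MeasurableSpace G] [TopologicalSpace G] [IsTopologicalGroup G] [CompactSpace G] [BorelSpace G]
variable {L' : ℕ} [NeZero L']

/-- ★ **Term of a decoder with translated link set**: `g^{=shiftLinks (−m̄) R₁}(thin(τ_v U)) = g^{=R₁}(W_{m̄,v} U)` for translation-invariant `g`. [folklore] -/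
theorem esPart_shiftLinks_reading {g : GaugeConfig 3 L' G → ℝ} (hg : Measurable g) {C : ℝ} (hC : ∀ U, |g U| ≤ C)
    (hTI : ∀ (w : Site 3 L') (U : GaugeConfig 3 L' G), g (torusConfigShift w U) = g U)
    (R₁ : Finset (Edge 3 L')) (mbar : Site 3 L') (v : Site 3 (L' + 1)) (U : GaugeConfig 3 (L' + 1) G) :
    esPart (haarProbability G) (shiftLinks (-mbar) R₁) g (thin L' (torusConfigShift v U)) =
      esPart (haarProbability G) R₁ g (fun e : Edge 3 L' => thin L' (torusConfigShift v U) (e.1 - mbar, e.2)) := by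
  unfold shiftLinks
  rw [esPart_image_shift hg hC hTI R₁ (-mbar)]
  simp only [neg_neg]
  congr 1
  funext e
  exact torusConfigShift_apply _ _ _

/-- ★ **Iterated merge steps**: if the coarse slices `x_j = m̄_j + 1, …, m̄_j + n` carry no transverse link of `R` then
`g^{=R}(W_{m̄ + n e_j, v − n e_j} U) = g^{=R}(W_{m̄,v} U)`. [folklore] -/
theorem esPart_reading_steps (hL : 2 ≤ L') {g : GaugeConfig 3 L' G → ℝ} (hg : Measurable g)
    (hGI : ∀ (k : Site 3 L' → G) (W : GaugeConfig 3 L' G), g (gaugeTransform k W) = g W)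
    (R : Finset (Edge 3 L')) (j : Fin 3) (mbar : Site 3 L') (v : Site 3 (L' + 1)) (n : ℕ)
    (hslices : ∀ t : ℕ, t < n → ∀ e ∈ R, e.1 j = mbar j + 1 + (t : ZMod L') → e.2 = j) (U : GaugeConfig 3 (L' + 1) G) :
    esPart (haarProbability G) R g
        (fun e : Edge 3 L' => thin L' (torusConfigShift (v - Pi.single j ((n : ℕ) : ZMod (L' + 1))) U)
          (e.1 - (mbar + Pi.single j ((n : ℕ) : ZMod L')), e.2)) =
      esPart (haarProbability G) R g (fun e : Edge 3 L' => thin L' (torusConfigShift v U) (e.1 - mbar, e.2)) := by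
  induction n with
  | zero => simp
  | succ n ih =>
    have ih' := ih (fun t ht => hslices t (by omega))
    -- one more step from `(m̄ + n e_j, v − n e_j)`
    have hstep := esPart_reading_step hL hg hGI R j (mbar + Pi.single j ((n : ℕ) : ZMod L')) (v - Pi.single j ((n : ℕ) : ZMod (L' + 1)))
      (fun e he hej => hslices n (by omega) e he (by rw [hej]; simp only [Pi.add_apply, Pi.single_eq_same]; ring)) U
    have e1 : mbar + Pi.single j (((n + 1 : ℕ) : ℕ) : ZMod L') = (mbar + Pi.single j ((n : ℕ) : ZMod L')) + Pi.single j 1 := by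
      rw [Nat.cast_succ, Pi.single_add, add_assoc]
    have e2 : v - Pi.single j (((n + 1 : ℕ) : ℕ) : ZMod (L' + 1)) = (v - Pi.single j ((n : ℕ) : ZMod (L' + 1))) - Pi.single j 1 := by
      rw [Nat.cast_succ, Pi.single_add, sub_sub]
    rw [e1, e2, ← hstep, ih']

/-- ★ **Polyakov direction**: if `R` is invariant under the unit translation in direction `j` and none of its `j`-slices carries a transverse link,
then the decoder component `v_j` is irrelevant: `g^{=R}(W_{m̄, v − n e_j} U) = g^{=R}(W_{m̄,v} U)`. [folklore] -/
theorem esPart_reading_polyakov (hL : 2 ≤ L') {g : GaugeConfig 3 L' G → ℝ} (hg : Measurable g) {C : ℝ} (hC : ∀ U, |g U| ≤ C)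
    (hGI : ∀ (k : Site 3 L' → G) (W : GaugeConfig 3 L' G), g (gaugeTransform k W) = g W)
    (hTI : ∀ (w : Site 3 L') (U : GaugeConfig 3 L' G), g (torusConfigShift w U) = g U)
    (R : Finset (Edge 3 L')) (j : Fin 3) (hinv : shiftLinks (Pi.single j (1 : ZMod L') : Site 3 L') R = R) (htrans : ∀ e ∈ R, e.2 = j)
    (mbar : Site 3 L') (v : Site 3 (L' + 1)) (n : ℕ) (U : GaugeConfig 3 (L' + 1) G) :
    esPart (haarProbability G) R g
        (fun e : Edge 3 L' => thin L' (torusConfigShift (v - Pi.single j ((n : ℕ) : ZMod (L' + 1))) U) (e.1 - mbar, e.2)) =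
      esPart (haarProbability G) R g (fun e : Edge 3 L' => thin L' (torusConfigShift v U) (e.1 - mbar, e.2)) := by
  -- merge steps move `m̄` by `n e_j`; translating `R` back by `n e_j` (invariance) removes the shift of `m̄`
  have h1 := esPart_reading_steps hL hg hGI R j mbar v n (fun t _ e he _ => htrans e he) U
  rw [← h1]
  -- `R = shiftLinks (-(n e_j)) R`, so `g^{=R}(W) = g^{=R}(τ_{n e_j} W)` … unfold via `esPart_shiftLinks_reading`
  have hm : shiftLinks (-(Pi.single j (1 : ZMod L')) : Site 3 L') R = R := by
    conv_lhs => rw [← hinv]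
    rw [shiftLinks_shiftLinks, neg_add_cancel]
    simp [shiftLinks]
  have hinvn : ∀ k : ℕ, shiftLinks (-(Pi.single j ((k : ℕ) : ZMod L')) : Site 3 L') R = R := by
    intro k
    induction k with
    | zero => simp [shiftLinks]
    | succ k ih =>
      have : (-(Pi.single j (((k + 1 : ℕ) : ℕ) : ZMod L')) : Site 3 L') =
          -(Pi.single j ((k : ℕ) : ZMod L')) + -(Pi.single j (1 : ZMod L')) := by
        rw [Nat.cast_succ, Pi.single_add, neg_add]
      rw [this, ← shiftLinks_shiftLinks, hm, ih]
  have h3 := esPart_shiftLinks_reading hg hC hTI R (mbar + Pi.single j ((n : ℕ) : ZMod L')) (v - Pi.single j ((n : ℕ) : ZMod (L' + 1))) U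
  have h4 := esPart_shiftLinks_reading hg hC hTI R mbar (v - Pi.single j ((n : ℕ) : ZMod (L' + 1))) U
  have hRR : shiftLinks (-(mbar + Pi.single j ((n : ℕ) : ZMod L'))) R = shiftLinks (-mbar) R := by
    rw [neg_add, ← shiftLinks_shiftLinks, hinvn n]
  rw [hRR, h4] at h3
  exact h3

end Summit.QuantumFields.YangMills.Theorems.FlatTubeReduction.Decimation
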